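import Summits.RiemannHypothesis.RiemannHypothesis.Theses.SpectralTrace
import Summits.RiemannHypothesis.RiemannHypothesis.Theorems.WindowTraceArch.Negative.LocalWeylTools
import Literature.NumberTheory.LFunctions.WeilArchimedeanPositivityProofs
import Literature.NumberTheory.LFunctions.WeilArchimedeanMoments
import Literature.NumberTheory.LFunctions.WeilMellinBounds
import Literature.Analysis.SpecialFunctions.DigammaGauss
import Literature.Analysis.SpecialFunctions.DigammaVerticalSeries
import HarnessLib

/-!
# `WindowTraceArch` — structural lemma: the local Weyl law (upper bound) for window families

Support lemmas for the crux `stmt-RiemannHypothesis-11195`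
(`Summit.RiemannHypothesis.RiemannHypothesis.Theses.SpectralTrace.WindowTraceArch`), recorded by
the standing disprover (`Cruxes/WindowTraceArch/Disproof.lean` §2d). Every real family `γ`
reproducing the Weil functional on the Weil tests supported in `[-A, A]` (`A > 0`) obeys

* `card_near_le_log_of_windowTrace` : `#{i ∈ s : |γ_i - T| ≤ 1} ≤ C (1 + log(1 + |T|))` for
  every finset `s` of such indices, with `C = C(min(A, log 2))` — UNIFORM in `A ≥ log 2`;
* `finite_near_of_windowTrace` : the unit windows `{i : |γ_i - T| ≤ 1}` are finite sets with
  `ncard ≤ C (1 + log(1 + |T|))`;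
* `finite_abs_le_of_windowTrace` : LOCAL FINITENESS, `{i : |γ_i| ≤ R}` is finite for all `R`;
* the `log 2` specialisations for `WindowTraceArch` witnesses.

Method: test the identity against the modulated autocorrelation `h_T ⋆ h̃_T`,
`h_T(t) = e^{-iTt} h(t)`, of a narrow bump (`exists_bump_lower`: `|ĥ(1/2+iv)|² ≥ c > 0` on
`|v| ≤ 1`; `weilMellin_modulate`: `ĥ_T(1/2+iu) = ĥ(1/2+i(u-T))`); the sum of the costs is
`Re Q(h_T)` (`weilMellin_weilConv_weilReflect_half`), which in Yoshida's analytic form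
(`weilQuadratic_re_eq_weilArchQuadratic`, no prime enters below `log 2`) is bounded using the
Stirling-type bound `Re ψ(1/4 + iu/2) ≤ 5 + log(1 + |u|)` (`reDigammaQuarter_le_log`, from
`re_digamma_le_log_norm_add` and `reDigammaQuarter_mono`) by
`2‖h‖²_{L¹,½} + K(h) + P(h)·log(1+|T|)`.

Together with `Negative/BoundedDensity.lean` (cells get arbitrarily crowded) this brackets the
local density of any witness between "unbounded" and `O(log T)` — the two halves of the
Riemann–von Mangoldt shape, with no arithmetic input. The upper bound is also the local
finiteness that an operator packaging (`SpectralPackaging`) or a vague-limit argument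
(`WindowCompactness`) of the route would need, uniform in the window.
-/

noncomputable section

open Complex Set MeasureTheory Filter
open scoped Real Topology ContDiff ComplexConjugate

namespace Summit.RiemannHypothesis.RiemannHypothesis.Theorems.WindowTraceArch.Negative

open Literature.NumberTheory.LFunctions
open Literature.Analysis.SpecialFunctions

/-! ### The local Weyl law: `O(log T)` points per unit interval -/

set_option maxHeartbeats 400000 in
/-- **Local Weyl upper bound for window-trace families.** If a real family `γ : ι → ℝ`
reproduces the Weil functional on every Weil test supported in `[-A, A]` (`A > 0`), then the
number of its points in any unit interval `[T-1, T+1]` is `O_A(1 + log(1 + |T|))`, with a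
constant depending only on `min(A, log 2)` (so UNIFORM in `A ≥ log 2`, as needed for passing to
the limit `A → ∞`). Proof: test the identity against the modulated autocorrelation of a narrow
bump `h` (`supp h ⊆ [-δ, δ]`, `δ = min(A/2, (log 2)/2, 1/2)`): each point in `[T-1, T+1]` costs
at least `c(h) > 0` (`exists_bump_lower`, `weilMellin_modulate`), the total is `Re Q(h_T)`
(`sum_norm_sq_le` via `weilMellin_weilConv_weilReflect_half`), and
`Re Q(h_T) = 2Re(ĥ_T(0)conj ĥ_T(1)) - log π‖h‖₂² + (1/2π)∫|ĥ(1/2+i(u-T))|² Re ψ(1/4+iu/2) du`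
(`weilQuadratic_re_eq_weilArchQuadratic`) is `≤ 2‖h‖²_{L¹,1/2} + K(h) + P(h) log(1+|T|)` by
`Re ψ(1/4+iu/2) ≤ 5 + log(1+|u|)` (`reDigammaQuarter_le_log`). [folklore] -/
theorem card_near_le_log_of_windowTrace {A : ℝ} (hA : 0 < A) {ι : Type*} {γ : ι → ℝ}
    (h : ∀ g : ℝ → ℂ, IsWeilTest g → tsupport g ⊆ Icc (-A) A →
      HasSum (fun i => weilMellin g (1 / 2 + (γ i : ℂ) * I)) (weilFunctional g)) :
    ∃ C : ℝ, 0 < C ∧ ∀ (T : ℝ) (s : Finset ι), (∀ i ∈ s, |γ i - T| ≤ 1) →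
      (s.card : ℝ) ≤ C * (1 + Real.log (1 + |T|)) := by
  -- the bump
  set δ : ℝ := min (A / 2) (min (Real.log 2 / 2) (1 / 2)) with hδ_def
  have hlog2 : 0 < Real.log 2 := Real.log_pos one_lt_two
  have hδ : 0 < δ := lt_min (half_pos hA) (lt_min (half_pos hlog2) one_half_pos)
  have hδA : δ ≤ A / 2 := min_le_left _ _
  have hδl : δ ≤ Real.log 2 / 2 := (min_le_right _ _).trans (min_le_left _ _)
  have hδ1 : δ ≤ 1 / 2 := (min_le_right _ _).trans (min_le_right _ _)
  obtain ⟨w, hw, hws, hw1, c, hc, hlow⟩ := exists_bump_lower hδ hδ1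
  -- constants
  set L : ℝ := weilL1 w with hL
  have hL0 : 0 ≤ L := weilL1_nonneg w
  set P : ℝ := ∫ v : ℝ, ‖weilMellin w (1 / 2 + v * I)‖ ^ 2 with hP
  have hP0 : 0 ≤ P := integral_nonneg fun _ => by positivity
  set K : ℝ := ∫ v : ℝ, ‖weilMellin w (1 / 2 + v * I)‖ ^ 2 * (5 + Real.log (1 + |v|)) with hK
  have hK0 : 0 ≤ K := integral_nonneg fun v => by
    have : 0 ≤ Real.log (1 + |v|) := Real.log_nonneg (by linarith [abs_nonneg v])
    positivity
  refine ⟨(2 * L ^ 2 + K + P + 1) / c, by positivity, fun T s hs => ?_⟩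
  -- the modulated test
  set wT : ℝ → ℂ := fun t => cexp (-((T * t : ℝ) : ℂ) * I) * w t with hwT_def
  have hwT : IsWeilTest wT := isWeilTest_modulate hw T
  have hwTs : tsupport wT ⊆ Icc (-δ) δ := (tsupport_modulate_subset w T).trans hws
  have hwTsA : tsupport wT ⊆ Icc (-(A / 2)) (A / 2) :=
    hwTs.trans (Icc_subset_Icc (by linarith) hδA)
  have hwTsl : tsupport wT ⊆ Icc (-(Real.log 2 / 2)) (Real.log 2 / 2) :=
    hwTs.trans (Icc_subset_Icc (by linarith) hδl)
  -- (1) lower bound: each point near `T` costs `c`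
  have hcount : (s.card : ℝ) * c ≤ ∑ i ∈ s, ‖weilMellin wT (1 / 2 + (γ i : ℂ) * I)‖ ^ 2 := by
    have : ∑ _i ∈ s, c ≤ ∑ i ∈ s, ‖weilMellin wT (1 / 2 + (γ i : ℂ) * I)‖ ^ 2 := by
      refine Finset.sum_le_sum fun i hi => ?_
      have e : weilMellin wT (1 / 2 + (γ i : ℂ) * I) =
          weilMellin w (1 / 2 + ((γ i - T : ℝ) : ℂ) * I) := weilMellin_modulate w T (γ i)
      rw [e]
      exact hlow (γ i - T) (hs i hi)
    rwa [Finset.sum_const, nsmul_eq_mul] at this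
  -- (2) the sum is bounded by `Re Q(w_T)`
  have hsum : ∑ i ∈ s, ‖weilMellin wT (1 / 2 + (γ i : ℂ) * I)‖ ^ 2 ≤ (weilQuadratic wT).re := by
    have hk : IsWeilTest (weilConv wT (weilReflect wT)) := hwT.weilConv hwT.weilReflect
    have hks : tsupport (weilConv wT (weilReflect wT)) ⊆ Icc (-A) A :=
      (tsupport_weilConv_weilReflect_subset hwT.2 hwTsA).trans
        (Icc_subset_Icc (by linarith) (by linarith))
    have hsumC : HasSum (fun i => (((‖weilMellin wT (1 / 2 + (γ i : ℂ) * I)‖ ^ 2 : ℝ) : ℂ)))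
        (weilFunctional (weilConv wT (weilReflect wT))) := by
      simpa only [weilMellin_weilConv_weilReflect_half hwT] using h _ hk hks
    have hsumR : HasSum (fun i => ‖weilMellin wT (1 / 2 + (γ i : ℂ) * I)‖ ^ 2)
        (weilFunctional (weilConv wT (weilReflect wT))).re := by
      simpa only [Complex.reCLM_apply, Complex.ofReal_re] using hsumC.mapL Complex.reCLM
    unfold weilQuadratic
    exact sum_le_hasSum s (fun _ _ => by positivity) hsumR
  -- (3) `Re Q(w_T)` in Yoshida's analytic form, bounded term by term
  have hQ : (weilQuadratic wT).re = weilArchQuadratic wT :=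
    weilQuadratic_re_eq_weilArchQuadratic hwT hwTsl
  -- (3a) polar part
  have hLT : weilL1 wT = L := by
    rw [hL, weilL1, weilL1]
    refine integral_congr_ae (Eventually.of_forall fun t => ?_)
    simp only [hwT_def, norm_modulate]
  have hpol : 2 * (weilMellin wT 0 * conj (weilMellin wT 1)).re ≤ 2 * L ^ 2 := by
    have h0 : ‖weilMellin wT 0‖ ≤ L := by
      rw [← hLT]; exact norm_weilMellin_le_weilL1 hwT.1.continuous hwT.2 (by simp) (by simp)
    have h1 : ‖weilMellin wT 1‖ ≤ L := by
      rw [← hLT]; exact norm_weilMellin_le_weilL1 hwT.1.continuous hwT.2 (by simp) (by simp)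
    have h2 : (weilMellin wT 0 * conj (weilMellin wT 1)).re ≤
        ‖weilMellin wT 0‖ * ‖weilMellin wT 1‖ := by
      refine (Complex.re_le_norm _).trans ?_
      rw [norm_mul, Complex.norm_conj]
    nlinarith [norm_nonneg (weilMellin wT 0), norm_nonneg (weilMellin wT 1)]
  -- (3b) the `L²` part is non-positive
  have hN : 0 ≤ Real.log π * ∫ t, ‖wT t‖ ^ 2 :=
    mul_nonneg (Real.log_nonneg (by linarith [Real.pi_gt_three]))
      (integral_nonneg fun _ => by positivity)
  -- (3c) the archimedean integral
  have hF : ∀ v : ℝ, |5 + Real.log (1 + |v|) + Real.log (1 + |T|)| ≤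
      (6 + Real.log (1 + |T|)) + (1 / 2) * v ^ 2 := by
    intro v
    have h1 : 0 ≤ Real.log (1 + |v|) := Real.log_nonneg (by linarith [abs_nonneg v])
    have h2 : 0 ≤ Real.log (1 + |T|) := Real.log_nonneg (by linarith [abs_nonneg T])
    have h3 : Real.log (1 + |v|) ≤ |v| := by
      have := Real.log_le_sub_one_of_pos (by linarith [abs_nonneg v] : (0 : ℝ) < 1 + |v|)
      linarith
    rw [abs_of_nonneg (by linarith)]
    nlinarith [sq_nonneg (|v| - 1), sq_abs v]
  have hint0 : Integrable fun v : ℝ => ‖weilMellin w (1 / 2 + v * I)‖ ^ 2 *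
      (5 + Real.log (1 + |v|) + Real.log (1 + |T|)) := by
    refine integrable_norm_sq_weilMellin_mul hw (by fun_prop) (by
      linarith [Real.log_nonneg (by linarith [abs_nonneg T] : (1 : ℝ) ≤ 1 + |T|)])
      (by norm_num) hF
  have hint1 : Integrable fun u : ℝ => ‖weilMellin w (1 / 2 + ((u - T : ℝ) : ℂ) * I)‖ ^ 2 *
      (5 + Real.log (1 + |u - T|) + Real.log (1 + |T|)) := by
    have := hint0.comp_sub_right T
    exact this
  have harch : ∫ u : ℝ, ‖weilMellin wT (1 / 2 + u * I)‖ ^ 2 *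
        (Complex.digamma (1 / 4 + u / 2 * I)).re ≤ K + Real.log (1 + |T|) * P := by
    calc ∫ u : ℝ, ‖weilMellin wT (1 / 2 + u * I)‖ ^ 2 * (Complex.digamma (1 / 4 + u / 2 * I)).re
        ≤ ∫ u : ℝ, ‖weilMellin w (1 / 2 + ((u - T : ℝ) : ℂ) * I)‖ ^ 2 *
            (5 + Real.log (1 + |u - T|) + Real.log (1 + |T|)) := by
          refine integral_mono (integrable_norm_sq_weilMellin_mul_reDigammaQuarter hwT) hint1
            fun u => ?_
          simp only
          rw [weilMellin_modulate w T u]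
          refine mul_le_mul_of_nonneg_left ?_ (by positivity)
          have h1 := reDigammaQuarter_le_log u
          have h2 : Real.log (1 + |u|) ≤ Real.log (1 + |u - T|) + Real.log (1 + |T|) := by
            rw [← Real.log_mul (by positivity) (by positivity)]
            refine Real.log_le_log (by positivity) ?_
            have : |u| ≤ |u - T| + |T| := by
              simpa using abs_add_le (u - T) T
            nlinarith [abs_nonneg (u - T), abs_nonneg T]
          change reDigammaQuarter u ≤ _
          linarith
      _ = ∫ v : ℝ, ‖weilMellin w (1 / 2 + v * I)‖ ^ 2 *
            (5 + Real.log (1 + |v|) + Real.log (1 + |T|)) := by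
          have := integral_sub_right_eq_self (μ := (volume : Measure ℝ))
            (fun v : ℝ => ‖weilMellin w (1 / 2 + v * I)‖ ^ 2 *
              (5 + Real.log (1 + |v|) + Real.log (1 + |T|))) T
          simpa using this
      _ = K + Real.log (1 + |T|) * P := by
          have e : (fun v : ℝ => ‖weilMellin w (1 / 2 + v * I)‖ ^ 2 *
              (5 + Real.log (1 + |v|) + Real.log (1 + |T|))) =
              fun v : ℝ => ‖weilMellin w (1 / 2 + v * I)‖ ^ 2 * (5 + Real.log (1 + |v|)) +
                Real.log (1 + |T|) * ‖weilMellin w (1 / 2 + v * I)‖ ^ 2 := by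
            funext v; ring
          have hi1 : Integrable fun v : ℝ => ‖weilMellin w (1 / 2 + v * I)‖ ^ 2 *
              (5 + Real.log (1 + |v|)) := by
            refine integrable_norm_sq_weilMellin_mul hw (by fun_prop) (by norm_num : (0:ℝ) ≤ 6)
              (by norm_num : (0:ℝ) ≤ 1 / 2) fun v => ?_
            have h1 : 0 ≤ Real.log (1 + |v|) := Real.log_nonneg (by linarith [abs_nonneg v])
            have h3 : Real.log (1 + |v|) ≤ |v| := by
              have := Real.log_le_sub_one_of_pos (by linarith [abs_nonneg v] : (0 : ℝ) < 1 + |v|)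
              linarith
            rw [abs_of_nonneg (by linarith)]
            nlinarith [sq_nonneg (|v| - 1), sq_abs v]
          have hi2 : Integrable fun v : ℝ =>
              Real.log (1 + |T|) * ‖weilMellin w (1 / 2 + v * I)‖ ^ 2 :=
            (integrable_norm_sq_weilMellin_half_line hw).const_mul _
          rw [e, integral_add hi1 hi2, MeasureTheory.integral_const_mul]
  -- (4) assemble
  have hQle : (weilQuadratic wT).re ≤ 2 * L ^ 2 + K + P * Real.log (1 + |T|) := by
    rw [hQ, weilArchQuadratic]
    have hpi : 1 / (2 * π) * (K + Real.log (1 + |T|) * P) ≤ K + Real.log (1 + |T|) * P := by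
      have hX : 0 ≤ K + Real.log (1 + |T|) * P := by
        have := Real.log_nonneg (by linarith [abs_nonneg T] : (1 : ℝ) ≤ 1 + |T|)
        positivity
      have h12 : 1 / (2 * π) ≤ 1 := by
        rw [div_le_one (by positivity)]; linarith [Real.pi_gt_three]
      nlinarith
    have harch' : 1 / (2 * π) * ∫ u : ℝ, ‖weilMellin wT (1 / 2 + u * I)‖ ^ 2 *
        (Complex.digamma (1 / 4 + u / 2 * I)).re ≤ 1 / (2 * π) * (K + Real.log (1 + |T|) * P) :=
      mul_le_mul_of_nonneg_left harch (by positivity)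
    nlinarith
  have hlogT : 0 ≤ Real.log (1 + |T|) := Real.log_nonneg (by linarith [abs_nonneg T])
  have hmain : (s.card : ℝ) * c ≤ 2 * L ^ 2 + K + P * Real.log (1 + |T|) :=
    hcount.trans (hsum.trans hQle)
  rw [div_mul_eq_mul_div, le_div_iff₀ hc]
  nlinarith

/-- **Local finiteness with a `log` bound.** For a window-trace family, every unit window
`{i : |γ_i - T| ≤ 1}` is a finite set of cardinality `≤ C (1 + log(1 + |T|))`. [folklore] -/
theorem finite_near_of_windowTrace {A : ℝ} (hA : 0 < A) {ι : Type*} {γ : ι → ℝ}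
    (h : ∀ g : ℝ → ℂ, IsWeilTest g → tsupport g ⊆ Icc (-A) A →
      HasSum (fun i => weilMellin g (1 / 2 + (γ i : ℂ) * I)) (weilFunctional g)) :
    ∃ C : ℝ, 0 < C ∧ ∀ T : ℝ, {i : ι | |γ i - T| ≤ 1}.Finite ∧
      (({i : ι | |γ i - T| ≤ 1}.ncard : ℕ) : ℝ) ≤ C * (1 + Real.log (1 + |T|)) := by
  obtain ⟨C, hC, hcard⟩ := card_near_le_log_of_windowTrace hA h
  refine ⟨C, hC, fun T => ?_⟩
  have hfin : {i : ι | |γ i - T| ≤ 1}.Finite := by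
    by_contra hinf
    obtain ⟨t, hts, htc⟩ := Set.Infinite.exists_subset_card_eq hinf
      (⌊C * (1 + Real.log (1 + |T|))⌋₊ + 1)
    have h1 := hcard T t fun i hi => hts (Finset.mem_coe.2 hi)
    rw [htc] at h1
    have h2 := Nat.lt_floor_add_one (C * (1 + Real.log (1 + |T|)))
    push_cast at h1
    linarith
  refine ⟨hfin, ?_⟩
  rw [Set.ncard_eq_toFinset_card _ hfin]
  exact hcard T hfin.toFinset fun i hi => (hfin.mem_toFinset.1 hi)

/-- **Local finiteness**: for a window-trace family, `{i : |γ_i| ≤ R}` is finite for every `R`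
(cover `[-R, R]` by the unit windows around the integers). [folklore] -/
theorem finite_abs_le_of_windowTrace {A : ℝ} (hA : 0 < A) {ι : Type*} {γ : ι → ℝ}
    (h : ∀ g : ℝ → ℂ, IsWeilTest g → tsupport g ⊆ Icc (-A) A →
      HasSum (fun i => weilMellin g (1 / 2 + (γ i : ℂ) * I)) (weilFunctional g)) (R : ℝ) :
    {i : ι | |γ i| ≤ R}.Finite := by
  obtain ⟨C, -, hC⟩ := finite_near_of_windowTrace hA h
  have hcov : {i : ι | |γ i| ≤ R} ⊆
      ⋃ k ∈ Set.Icc (-(⌈R⌉ + 1)) (⌈R⌉ + 1), {i : ι | |γ i - (k : ℤ)| ≤ 1} := by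
    intro i hi
    simp only [Set.mem_setOf_eq] at hi
    simp only [Set.mem_iUnion, Set.mem_setOf_eq, Set.mem_Icc, exists_prop]
    refine ⟨⌊γ i⌋, ⟨?_, ?_⟩, ?_⟩
    · have h1 : (⌊γ i⌋ : ℝ) > γ i - 1 := by linarith [Int.lt_floor_add_one (γ i)]
      have h2 : γ i - 1 ≥ -R - 1 := by linarith [neg_abs_le (γ i), (abs_le.1 hi).1]
      have h3 : (-(⌈R⌉ + 1) : ℝ) ≤ -R - 1 := by
        have := Int.le_ceil R
        linarith
      have : ((-(⌈R⌉ + 1) : ℤ) : ℝ) < (⌊γ i⌋ : ℝ) := by push_cast; linarith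
      exact_mod_cast this.le
    · have h1 : (⌊γ i⌋ : ℝ) ≤ γ i := Int.floor_le (γ i)
      have h2 : γ i ≤ R := (abs_le.1 hi).2
      have h3 : (R : ℝ) ≤ ⌈R⌉ := Int.le_ceil R
      have : (⌊γ i⌋ : ℝ) ≤ ((⌈R⌉ + 1 : ℤ) : ℝ) := by push_cast; linarith
      exact_mod_cast this
    · rw [abs_le]
      constructor <;> linarith [Int.floor_le (γ i), Int.lt_floor_add_one (γ i)]
  exact ((Set.finite_Icc (-(⌈R⌉ + 1)) (⌈R⌉ + 1)).biUnion
    (t := fun k : ℤ => {i : ι | |γ i - (k : ℝ)| ≤ 1}) fun k _ => (hC (k : ℝ)).1).subset hcov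

/-- The crux window `[-log 2, log 2]`: `O(log T)` points per unit interval. [folklore] -/
theorem card_near_le_log_of_windowTraceArch_witness {ι : Type} {γ : ι → ℝ}
    (h : ∀ g : ℝ → ℂ, IsWeilTest g → tsupport g ⊆ Icc (-Real.log 2) (Real.log 2) →
      HasSum (fun i => weilMellin g (1 / 2 + (γ i : ℂ) * I)) (weilFunctional g)) :
    ∃ C : ℝ, 0 < C ∧ ∀ (T : ℝ) (s : Finset ι), (∀ i ∈ s, |γ i - T| ≤ 1) →
      (s.card : ℝ) ≤ C * (1 + Real.log (1 + |T|)) :=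
  card_near_le_log_of_windowTrace (Real.log_pos one_lt_two) h

/-- The crux window: local finiteness of every `WindowTraceArch` witness. [folklore] -/
theorem finite_abs_le_of_windowTraceArch_witness {ι : Type} {γ : ι → ℝ}
    (h : ∀ g : ℝ → ℂ, IsWeilTest g → tsupport g ⊆ Icc (-Real.log 2) (Real.log 2) →
      HasSum (fun i => weilMellin g (1 / 2 + (γ i : ℂ) * I)) (weilFunctional g)) (R : ℝ) :
    {i : ι | |γ i| ≤ R}.Finite :=
  finite_abs_le_of_windowTrace (Real.log_pos one_lt_two) h R

end Summit.RiemannHypothesis.RiemannHypothesis.Theorems.WindowTraceArch.Negative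

end
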